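import Literature.MathematicalPhysics.QuantumFieldTheory.BalabanImbrieJaffe1984to88.BIJ88Sect5StatementsPart2
import Literature.MathematicalPhysics.QuantumFieldTheory.BalabanImbrieJaffe1984to88.BIJ88ScaleSums

/-!
# `BalabanImbrieJaffe1984to88.BIJ88Ineq5714Proof` — T. Bałaban, J. Imbrie, A. Jaffe, *Effective action and cluster
properties of the abelian Higgs model*, Commun. Math. Phys. **114** (1988) 257–315 [BalabanImbrieJaffe1988]:
**(5.7.14)** p. 295 PROVED as the KNITTING of the six printed piece bounds of Sect. 5.7 (pp. 291–295) — *"We can summarize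
the results of this section as follows: … where X is a connected union of r(e_k)-cubes in T₁^{(k)}, W₂^{(k)}(X) = Σ_{j=0}^{k}
W^{(j)′}(X) + … + W^{(j)(vi)}(X), |W₂^{(k)}(X)| ≤ e_k^κ e^{−cr(e_k)|X|^−} + Σ_{j<k} e_j^{1−α} e^{−cr(e_k)|X|} |B_{k−j−1}(X) ∩ Λ₅^{(j)′} ∩
Λ₆^{(j+1)c}|, (5.7.14)"* — for r16's typed leaf `BIJ88Sect5StatementsPart2.Ineq5714` (kind «knitting / model-instance»: the leaf
quantifies over an abstract polymer functional `W₂`; here `W₂` IS the printed sum of the six families over the scales `j ≤ k`, the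
families carry the printed bounds as hypotheses, and the running charge is r18's (2.2) `BIJ88Sect2Statements.eK`).

statement-level skeleton of published theorems with citation tags; proofs where landed; nothing here is a claim about the Yang–Mills mass gap

PDF held: `paper:balaban1988-cmp114-bij-abelian-higgs-effective-action` (journal page = PDF page + 256).  Pages read as images:
PDF pp. 33–39 (journal 289–295), `g4png.py` ×2 renders (seat folder `renders/original-p033-x2.png` … `-p039-x2.png`).

CITATION HEADER (lean-in-tree rule).  Part of the lit-balaban TYPED SKELETON (HOME `run/shared/lean/pub/lit-balaban/`), Phase 2,
seat p36 (gen 4, unit `lit-balaban-p36`); row **C2.Eq5.7.13-5.7.15** of `HOME/lit-balaban-r16/ROWS-C2-part2.md` (leaf `Ineq5714` typed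
p240155, r16); multiscale arithmetic in the companion `BIJ88ScaleSums` (same seat).  WHAT IS REPRODUCED, and how (theorem-only file;
every constant explicit; no new `Prop` facts; axioms standard).
THE SIX PRINTED PIECE BOUNDS (verbatim): (5.7.9) p. 291 *"|W^{(j)′}(X)| ≤ … ≤ e_j^κ e^{−cr(e_k)|X|^−}"*; p. 292 *"|W^{(j)″}(X)| ≤
e_j^{1−α} e^{−cr(e_k)|X|} |X′ ∩ Λ₅^{(j)′} ∩ Λ₆^{(j+1)c}|"*; p. 293 *"Σ_X W^{(j)‴}(X), with |W^{(j)‴}(X)| ≤ e^{−cr(e_j)|X|}"* and *"Σ_X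
W^{(j)(iv)}(X), with |W^{(j)(iv)}(X)| ≤ e^{−cr(e_j)|X|}"*; p. 294 *"Σ_X W^{(j)(v)}(X), with |W^{(j)(v)}(X)| ≤ e^{−cr(e_j)|X|}"* and (m < k)
*"|W^{(m)(vi)}(X)| ≤ e_m^{1−α} e^{−cr(e_k)|X|} |X ∩ Λ₅^{(m)′} ∩ Λ₆^{(m+1)c}|"*; p. 295 (m = k) *"The remainder terms become Σ_X W^{(k)(vi)}(X),
with |W^{(k)(vi)}(X)| ≤ e^{−cr(e_k)|X|}"*.  They are of THREE SHAPES: (S1) `n·e_j^κ e^{−cr(e_k)|X|^−}` (j ≤ k), (S2) `n·e_j^{1−α}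
e^{−cr(e_k)|X|}·vol_j(X)` with `vol_j(X) ≤ |B_{k−j−1}(X) ∩ Λ₅^{(j)′} ∩ Λ₆^{(j+1)c}|` (j < k; `X′, X ⊂ B_{k−j−1}(X)`), (S3) `n·e^{−cr(e_j)|X|}` (j ≤ k).
* §1 `ineq5714_knit`: for running charges `e_j = e_k q^{k−j}` (`0 < q < 1`, `0 < e_k ≤ 1`), (2.3) with `r > 1`, `c > 0`, polymers with
  `|X| ≥ 1`: if `W₂(X) = Σ_{j≤k} A_j(X) + Σ_{j<k} B_j(X) + Σ_{j≤k} D_j(X)` with families of shapes (S1), (S2), (S3) (multiplicities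
  `n_A, n_B, n_D`), then **`Ineq5714 P W₂ k e vol (κ − τ) (α + τ) c r(e_k)`** for every `τ > 0` once `e_k` is small — per-scale gain
  `c·r·(log e_k⁻¹)^{r−1}·log q⁻¹ ≥ log 2`, `κ ≤ c(log e_k⁻¹)^{r−1}`, `(n_A/(1−q^κ) + 2n_D) e_k^τ ≤ 1`, `n_B e_k^τ ≤ 1`.  MECHANISM (the
  print's *"sum over j"*): `Σ_{j≤k} e_j^κ ≤ e_k^κ/(1−q^κ)`; `Σ_{j≤k} e^{−cr(e_j)|X|} ≤ 2e^{−cr(e_k)|X|} = 2e^{−cr(e_k)}e^{−cr(e_k)|X|^−} ≤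
  2e_k^κ e^{−cr(e_k)|X|^−}` (`BIJ88ScaleSums`); the print's generic `κ` (*"We can take κ arbitrarily large"*, p. 291) and `α` absorb the
  O(1) multiplicities as `κ ↦ κ − τ`, `1 − α ↦ 1 − α − τ` — as typed, (5.7.14) carries coefficient 1.
* §2 `ineq5714_pieces`: THE VERBATIM INSTANCE — `W₂^{(k)}(X) = Σ_{j≤k}(W′_j + W″_j + W‴_j + W⁽ⁱᵛ⁾_j + W⁽ᵛ⁾_j + W⁽ᵛⁱ⁾_j)(X)` on r18's (2.2)
  `e_j = eK L ε e d j` (`L > 1`, `d < 4`, ratio `q = L^{−(4−d)/2}`), the six families bounded as printed (W″, W⁽ᵛⁱ⁾ for `j < k` with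
  volumes `≤ lfVol j X`; W⁽ᵛⁱ⁾_k as on p. 295), `n_A = 2`, `n_B = 2`, `n_D = 4`.  READING NOTE (recorded in HOME/GAPS.md): the print gives
  no separate bound for the `j = k` member of the ″-family (p. 295: the `m = k` terms with `w₅A′` fields are *"expanded as in the m < k
  case"*), while (5.7.14) has volume terms for `j < k` only; consistently with (5.7.14) it enters here with the (S1)-shape hypothesis
  `|W″_k(X)| ≤ e_k^κ e^{−cr(e_k)|X|^−}` (`h2k`).
NOT here: the pieces themselves (the perturbative / random-walk expansions of Sect. 5.7), the identity (5.7.13) and the definition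
(5.7.15) (absent at the reader level), the region geometry behind `vol_j(X) ≤ |B_{k−j−1}(X) ∩ Λ₅^{(j)′} ∩ Λ₆^{(j+1)c}|` (hypotheses
`hvol₂`, `hvol₆`).
-/

namespace Literature.MathematicalPhysics.QuantumFieldTheory.BalabanImbrieJaffe1984to88.BIJ88Ineq5714Proof

open Finset
open BIJ88Sect2Statements (rLen eK)
open BIJ88Sect5StatementsPart2 BIJ88ScaleSums

/-! ## §1 The knitting: (5.7.14) from the three printed shapes -/

section Knit

variable (P : PolymerSys)

/-- `|X|^− = |X| − 1` for a non-empty polymer (p. 290 *"|X|^− = max{0, |X| − 1}"*; every X of (5.7.13) is a non-empty connected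
union of r(e_k)-cubes). [cite: BalabanImbrieJaffe1988, (5.7.7) p.290] -/
theorem cardMinus_cast {X : P.Poly} (hX : 1 ≤ P.card X) : (P.cardMinus X : ℝ) = (P.card X : ℝ) - 1 := by
  unfold PolymerSys.cardMinus
  rw [Nat.cast_sub hX, Nat.cast_one]

/-- `e^{−c r_k |X|} = e^{−c r_k} · e^{−c r_k |X|^−}` for a non-empty polymer: one power of `e^{−cr(e_k)}` is freed when an `|X|`-decay is
weakened to an `|X|^−`-decay. [cite: BalabanImbrieJaffe1988, (5.7.14) p.295] -/
theorem exp_card_eq_mul_exp_cardMinus {X : P.Poly} (hX : 1 ≤ P.card X) (a : ℝ) :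
    Real.exp (-a * P.card X) = Real.exp (-a) * Real.exp (-a * P.cardMinus X) := by
  rw [← Real.exp_add, cardMinus_cast P hX]
  ring_nf

/-- **(5.7.14) KNITTED.**  Running charges `e_j = e_k q^{k−j}` (`0 < q < 1`, `0 < e_k ≤ 1`), localization length (2.3) with `r > 1`,
`c > 0`, polymers with `|X| ≥ 1`, and `W₂(X) = Σ_{j≤k} A_j(X) + Σ_{j<k} B_j(X) + Σ_{j≤k} D_j(X)` where the three families carry the
three printed shapes of Sect. 5.7 — (S1) `|A_j(X)| ≤ n_A e_j^κ e^{−cr(e_k)|X|^−}` (the W′-pieces, (5.7.9)), (S2) `|B_j(X)| ≤ n_B e_j^{1−α}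
e^{−cr(e_k)|X|} vol_j(X)` (the W″- and W⁽ᵛⁱ⁾-pieces, j < k, pp. 292/294), (S3) `|D_j(X)| ≤ n_D e^{−cr(e_j)|X|}` (the W‴-, W⁽ⁱᵛ⁾-,
W⁽ᵛ⁾-pieces and W⁽ᵛⁱ⁾_k, pp. 293–295).  If `e_k` is small — per-scale gain `c·r·(log e_k⁻¹)^{r−1}·log q⁻¹ ≥ log 2`, `κ ≤ c(log e_k⁻¹)^{r−1}`,
`(n_A/(1−q^κ) + 2n_D) e_k^τ ≤ 1`, `n_B e_k^τ ≤ 1` — then `W₂` satisfies the typed (5.7.14) `Ineq5714` with exponents `κ − τ`, `α + τ`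
(any `τ > 0`): *"|W₂^{(k)}(X)| ≤ e_k^κ e^{−cr(e_k)|X|^−} + Σ_{j<k} e_j^{1−α} e^{−cr(e_k)|X|} |B_{k−j−1}(X) ∩ Λ₅^{(j)′} ∩ Λ₆^{(j+1)c}|"*.
[cite: BalabanImbrieJaffe1988, (5.7.14) p.295] -/
theorem ineq5714_knit (hcard : ∀ X, 1 ≤ P.card X) {e : ℕ → ℝ} {q : ℝ} {k : ℕ}
    (he : ∀ j, j ≤ k → e j = e k * q ^ (k - j)) (hq0 : 0 < q) (hq1 : q < 1) (hek : 0 < e k) (hek1 : e k ≤ 1)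
    {r c κ α τ nA nB nD : ℝ} (hr : 1 < r) (hc : 0 < c) (hκ : 0 < κ) (hτ : 0 < τ) (hnA : 0 ≤ nA) (hnB : 0 ≤ nB) (hnD : 0 ≤ nD)
    (A B D : ℕ → P.Poly → ℝ) (vol : ℕ → P.Poly → ℕ) (W₂ : P.Poly → ℝ)
    (hW : ∀ X, W₂ X = (∑ j ∈ Finset.range (k + 1), A j X) + (∑ j ∈ Finset.range k, B j X) +
      ∑ j ∈ Finset.range (k + 1), D j X)
    (hA : ∀ j, j ≤ k → ∀ X, |A j X| ≤ nA * e j ^ κ * Real.exp (-(c * rLen r (e k)) * P.cardMinus X))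
    (hB : ∀ j, j < k → ∀ X, |B j X| ≤ nB * e j ^ (1 - α) * Real.exp (-(c * rLen r (e k)) * P.card X) * vol j X)
    (hD : ∀ j, j ≤ k → ∀ X, |D j X| ≤ nD * Real.exp (-(c * rLen r (e j)) * P.card X))
    (hg : Real.log 2 ≤ c * r * Real.log (e k)⁻¹ ^ (r - 1) * Real.log q⁻¹)
    (hκR : κ ≤ c * Real.log (e k)⁻¹ ^ (r - 1))
    (hAτ : (nA / (1 - q ^ κ) + 2 * nD) * e k ^ τ ≤ 1) (hBτ : nB * e k ^ τ ≤ 1) :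
    Ineq5714 P W₂ k e vol (κ - τ) (α + τ) c (rLen r (e k)) := by
  intro X
  have hX := hcard X
  set rk := rLen r (e k) with hrk
  set EA := Real.exp (-(c * rk) * P.cardMinus X) with hEA
  set EB := Real.exp (-(c * rk) * P.card X) with hEB
  have hn1 : (1 : ℝ) ≤ P.card X := by exact_mod_cast hX
  have hEA0 : 0 < EA := Real.exp_pos _
  have hEB0 : 0 < EB := Real.exp_pos _
  have hekκ0 : 0 ≤ e k ^ κ := Real.rpow_nonneg hek.le κ
  have hQ1 : q ^ κ < 1 := Real.rpow_lt_one hq0.le hq1 hκ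
  have h1Q : 0 < 1 - q ^ κ := by linarith
  -- (S1): the A-family
  have hSA : |∑ j ∈ Finset.range (k + 1), A j X| ≤ nA / (1 - q ^ κ) * e k ^ κ * EA := by
    calc |∑ j ∈ Finset.range (k + 1), A j X| ≤ ∑ j ∈ Finset.range (k + 1), |A j X| := Finset.abs_sum_le_sum_abs _ _
      _ ≤ ∑ j ∈ Finset.range (k + 1), nA * e j ^ κ * EA :=
          Finset.sum_le_sum fun j hj => hA j (Nat.lt_succ_iff.mp (Finset.mem_range.mp hj)) X
      _ = nA * EA * ∑ j ∈ Finset.range (k + 1), e j ^ κ := by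
          rw [Finset.mul_sum]; exact Finset.sum_congr rfl fun j _ => by ring
      _ ≤ nA * EA * (e k ^ κ / (1 - q ^ κ)) :=
          mul_le_mul_of_nonneg_left (sum_rpow_scale_le he hq0 hq1 hek hκ) (mul_nonneg hnA hEA0.le)
      _ = nA / (1 - q ^ κ) * e k ^ κ * EA := by
          field_simp
  -- (S3): the D-family
  have hSD : |∑ j ∈ Finset.range (k + 1), D j X| ≤ 2 * nD * e k ^ κ * EA := by
    have hsum := sum_exp_rLen_scale_le he hq0 hq1.le hek hek1 hr hc.le hn1 hg
    have hsplit : Real.exp (-(c * rk) * P.card X) = Real.exp (-(c * rk)) * EA :=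
      exp_card_eq_mul_exp_cardMinus P hX (c * rk)
    have hsmall : Real.exp (-(c * rk)) ≤ e k ^ κ := exp_rLen_le_rpow hek hek1 hr hκR
    calc |∑ j ∈ Finset.range (k + 1), D j X| ≤ ∑ j ∈ Finset.range (k + 1), |D j X| := Finset.abs_sum_le_sum_abs _ _
      _ ≤ ∑ j ∈ Finset.range (k + 1), nD * Real.exp (-(c * rLen r (e j)) * P.card X) :=
          Finset.sum_le_sum fun j hj => hD j (Nat.lt_succ_iff.mp (Finset.mem_range.mp hj)) X
      _ = nD * ∑ j ∈ Finset.range (k + 1), Real.exp (-(c * rLen r (e j)) * P.card X) := by rw [Finset.mul_sum]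
      _ ≤ nD * (2 * Real.exp (-(c * rk) * P.card X)) := mul_le_mul_of_nonneg_left hsum hnD
      _ = 2 * nD * (Real.exp (-(c * rk)) * EA) := by rw [hsplit]; ring
      _ ≤ 2 * nD * (e k ^ κ * EA) :=
          mul_le_mul_of_nonneg_left (mul_le_mul_of_nonneg_right hsmall hEA0.le) (by positivity)
      _ = 2 * nD * e k ^ κ * EA := by ring
  -- (S1) + (S3) absorbed into e_k^{κ−τ}
  have hSAD : |∑ j ∈ Finset.range (k + 1), A j X| + |∑ j ∈ Finset.range (k + 1), D j X| ≤ e k ^ (κ - τ) * EA := by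
    have hsplitκ : e k ^ κ = e k ^ (κ - τ) * e k ^ τ := by
      rw [← Real.rpow_add hek]; ring_nf
    calc |∑ j ∈ Finset.range (k + 1), A j X| + |∑ j ∈ Finset.range (k + 1), D j X|
        ≤ nA / (1 - q ^ κ) * e k ^ κ * EA + 2 * nD * e k ^ κ * EA := add_le_add hSA hSD
      _ = ((nA / (1 - q ^ κ) + 2 * nD) * e k ^ τ) * (e k ^ (κ - τ) * EA) := by rw [hsplitκ]; ring
      _ ≤ 1 * (e k ^ (κ - τ) * EA) :=
          mul_le_mul_of_nonneg_right hAτ (mul_nonneg (Real.rpow_nonneg hek.le _) hEA0.le)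
      _ = e k ^ (κ - τ) * EA := one_mul _
  -- (S2): the B-family, termwise
  have hSB : |∑ j ∈ Finset.range k, B j X| ≤ ∑ j ∈ Finset.range k, e j ^ (1 - (α + τ)) * EB * vol j X := by
    refine (Finset.abs_sum_le_sum_abs _ _).trans (Finset.sum_le_sum fun j hj => ?_)
    have hjk : j < k := Finset.mem_range.mp hj
    obtain ⟨hej0, hejk⟩ := scale_pos_le he hq0 hq1.le hek hjk.le
    refine (hB j hjk X).trans ?_
    have hsplit : e j ^ (1 - α) = e j ^ (1 - (α + τ)) * e j ^ τ := by
      rw [← Real.rpow_add hej0]; ring_nf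
    have hjτ : nB * e j ^ τ ≤ 1 :=
      (mul_le_mul_of_nonneg_left (Real.rpow_le_rpow hej0.le hejk hτ.le) hnB).trans hBτ
    have hvol : (0 : ℝ) ≤ vol j X := Nat.cast_nonneg _
    calc nB * e j ^ (1 - α) * EB * vol j X = (nB * e j ^ τ) * (e j ^ (1 - (α + τ)) * EB * vol j X) := by
          rw [hsplit]; ring
      _ ≤ 1 * (e j ^ (1 - (α + τ)) * EB * vol j X) :=
          mul_le_mul_of_nonneg_right hjτ (mul_nonneg (mul_nonneg (Real.rpow_nonneg hej0.le _) hEB0.le) hvol)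
      _ = e j ^ (1 - (α + τ)) * EB * vol j X := one_mul _
  -- assemble
  rw [hW X]
  calc |(∑ j ∈ Finset.range (k + 1), A j X) + (∑ j ∈ Finset.range k, B j X) + ∑ j ∈ Finset.range (k + 1), D j X|
      ≤ |∑ j ∈ Finset.range (k + 1), A j X| + |∑ j ∈ Finset.range k, B j X| + |∑ j ∈ Finset.range (k + 1), D j X| :=
        abs_add_three _ _ _
    _ = (|∑ j ∈ Finset.range (k + 1), A j X| + |∑ j ∈ Finset.range (k + 1), D j X|) + |∑ j ∈ Finset.range k, B j X| := by ring
    _ ≤ e k ^ (κ - τ) * EA + ∑ j ∈ Finset.range k, e j ^ (1 - (α + τ)) * EB * vol j X := add_le_add hSAD hSB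

end Knit


/-! ## §2 The verbatim instance on the running charge (2.2): the six families of Sect. 5.7 -/

section Pieces

variable (P : PolymerSys)

/-- bookkeeping: the printed sum `Σ_{j≤k}(W′_j + W″_j + W‴_j + W⁽ⁱᵛ⁾_j + W⁽ᵛ⁾_j + W⁽ᵛⁱ⁾_j)` regrouped by shape — (S1): `W′_j` and `W″_k`;
(S2): `W″_j + W⁽ᵛⁱ⁾_j`, `j < k`; (S3): `W‴_j + W⁽ⁱᵛ⁾_j + W⁽ᵛ⁾_j` and `W⁽ᵛⁱ⁾_k`. [cite: BalabanImbrieJaffe1988, (5.7.14) p.295] -/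
theorem regroup_six (W₁ W₂ W₃ W₄ W₅ W₆ : ℕ → P.Poly → ℝ) (k : ℕ) (X : P.Poly) :
    ∑ j ∈ Finset.range (k + 1), (W₁ j X + W₂ j X + W₃ j X + W₄ j X + W₅ j X + W₆ j X) =
      (∑ j ∈ Finset.range (k + 1), (W₁ j X + if j = k then W₂ j X else 0)) +
      (∑ j ∈ Finset.range k, (W₂ j X + W₆ j X)) +
      ∑ j ∈ Finset.range (k + 1), (W₃ j X + W₄ j X + W₅ j X + if j = k then W₆ j X else 0) := by
  have hk : k ∈ Finset.range (k + 1) := Finset.mem_range.mpr (Nat.lt_succ_self k)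
  simp only [Finset.sum_add_distrib, Finset.sum_ite_eq' (Finset.range (k + 1)) k, if_pos hk, Finset.sum_range_succ]
  ring

/-- **(5.7.14), THE VERBATIM INSTANCE.**  On r18's running charge (2.2) `e_j = eK L ε e d j` (`L > 1`, `ε, e > 0`, `d < 4`, `e_k ≤ 1`)
and localization length (2.3) `r(e) = |log e⁻¹|^r` (`r > 1`), `c > 0`, polymers with `|X| ≥ 1`: let the six families of Sect. 5.7 obey
the printed bounds — (5.7.9) `|W′_j(X)| ≤ e_j^κ e^{−cr(e_k)|X|^−}` (j ≤ k); p. 292 `|W″_j(X)| ≤ e_j^{1−α}e^{−cr(e_k)|X|}vol″_j(X)` (j < k;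
`W″_k` with the (S1)-shape, see the file header); pp. 293–294 `|W‴_j|, |W⁽ⁱᵛ⁾_j|, |W⁽ᵛ⁾_j| ≤ e^{−cr(e_j)|X|}` (j ≤ k); p. 294
`|W⁽ᵛⁱ⁾_j(X)| ≤ e_j^{1−α}e^{−cr(e_k)|X|}vol⁽ᵛⁱ⁾_j(X)` (j < k), p. 295 `|W⁽ᵛⁱ⁾_k(X)| ≤ e^{−cr(e_k)|X|}`; volumes `≤ lfVol j X = |B_{k−j−1}(X) ∩
Λ₅^{(j)′} ∩ Λ₆^{(j+1)c}|`.  Then `W₂^{(k)} = Σ_{j≤k}(W′_j + … + W⁽ᵛⁱ⁾_j)` satisfies *"|W₂^{(k)}(X)| ≤ e_k^κ e^{−cr(e_k)|X|^−} + Σ_{j<k} e_j^{1−α}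
e^{−cr(e_k)|X|} |B_{k−j−1}(X) ∩ Λ₅^{(j)′} ∩ Λ₆^{(j+1)c}|"* — the typed `Ineq5714` with exponents `κ − τ`, `α + τ` — for every `τ > 0`
once `e_k` is small: `log 2 ≤ c·r·(log e_k⁻¹)^{r−1}·((4−d)/2) log L`, `κ ≤ c (log e_k⁻¹)^{r−1}`, `(2/(1 − L^{−(4−d)κ/2}) + 8) e_k^τ ≤ 1`.
[cite: BalabanImbrieJaffe1988, (5.7.14) p.295] -/
theorem ineq5714_pieces (hcard : ∀ X, 1 ≤ P.card X) {L ε e₀ : ℝ} {d : ℕ} (hL : 1 < L) (hε : 0 < ε) (he₀ : 0 < e₀)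
    (hd : d < 4) (k : ℕ) (hek1 : eK L ε e₀ d k ≤ 1) {r c κ α τ : ℝ} (hr : 1 < r) (hc : 0 < c) (hκ : 0 < κ) (hτ : 0 < τ)
    (W₁ W₂ W₃ W₄ W₅ W₆ : ℕ → P.Poly → ℝ) (vol₂ vol₆ lfVol : ℕ → P.Poly → ℕ)
    (hvol₂ : ∀ j X, vol₂ j X ≤ lfVol j X) (hvol₆ : ∀ j X, vol₆ j X ≤ lfVol j X)
    (h1 : ∀ j, j ≤ k → ∀ X, |W₁ j X| ≤
      eK L ε e₀ d j ^ κ * Real.exp (-(c * rLen r (eK L ε e₀ d k)) * P.cardMinus X))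
    (h2 : ∀ j, j < k → ∀ X, |W₂ j X| ≤
      eK L ε e₀ d j ^ (1 - α) * Real.exp (-(c * rLen r (eK L ε e₀ d k)) * P.card X) * vol₂ j X)
    (h2k : ∀ X, |W₂ k X| ≤ eK L ε e₀ d k ^ κ * Real.exp (-(c * rLen r (eK L ε e₀ d k)) * P.cardMinus X))
    (h3 : ∀ j, j ≤ k → ∀ X, |W₃ j X| ≤ Real.exp (-(c * rLen r (eK L ε e₀ d j)) * P.card X))
    (h4 : ∀ j, j ≤ k → ∀ X, |W₄ j X| ≤ Real.exp (-(c * rLen r (eK L ε e₀ d j)) * P.card X))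
    (h5 : ∀ j, j ≤ k → ∀ X, |W₅ j X| ≤ Real.exp (-(c * rLen r (eK L ε e₀ d j)) * P.card X))
    (h6 : ∀ j, j < k → ∀ X, |W₆ j X| ≤
      eK L ε e₀ d j ^ (1 - α) * Real.exp (-(c * rLen r (eK L ε e₀ d k)) * P.card X) * vol₆ j X)
    (h6k : ∀ X, |W₆ k X| ≤ Real.exp (-(c * rLen r (eK L ε e₀ d k)) * P.card X))
    (W : P.Poly → ℝ)
    (hW : ∀ X, W X = ∑ j ∈ Finset.range (k + 1), (W₁ j X + W₂ j X + W₃ j X + W₄ j X + W₅ j X + W₆ j X))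
    (hg : Real.log 2 ≤ c * r * Real.log (eK L ε e₀ d k)⁻¹ ^ (r - 1) * ((4 - (d : ℝ)) / 2 * Real.log L))
    (hκR : κ ≤ c * Real.log (eK L ε e₀ d k)⁻¹ ^ (r - 1))
    (hAτ : (2 / (1 - (L ^ (-((4 - (d : ℝ)) / 2))) ^ κ) + 8) * eK L ε e₀ d k ^ τ ≤ 1) :
    Ineq5714 P W k (fun j => eK L ε e₀ d j) lfVol (κ - τ) (α + τ) c (rLen r (eK L ε e₀ d k)) := by
  have hL0 : 0 < L := by linarith
  obtain ⟨hq0, hq1⟩ := ratio_pos_lt_one hL hd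
  have he := eK_scale_family (d := d) hL0 hε e₀ k
  have hek : 0 < eK L ε e₀ d k := eK_pos hL0 hε he₀ k
  set e : ℕ → ℝ := fun j => eK L ε e₀ d j with he_def
  have hek' : 0 < e k := hek
  -- smallness in the abstract form
  have hg' : Real.log 2 ≤ c * r * Real.log (e k)⁻¹ ^ (r - 1) * Real.log (L ^ (-((4 - (d : ℝ)) / 2)))⁻¹ := by
    rw [log_inv_ratio (d := d) hL0]; exact hg
  have hBτ : 2 * e k ^ τ ≤ 1 := by
    have h8 : 0 ≤ 2 / (1 - (L ^ (-((4 - (d : ℝ)) / 2))) ^ κ) + 8 - 2 := by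
      have : (L ^ (-((4 - (d : ℝ)) / 2))) ^ κ < 1 := Real.rpow_lt_one hq0.le hq1 hκ
      have : 0 < 1 - (L ^ (-((4 - (d : ℝ)) / 2))) ^ κ := by linarith
      have : 0 ≤ 2 / (1 - (L ^ (-((4 - (d : ℝ)) / 2))) ^ κ) := by positivity
      linarith
    have hτ0 : 0 ≤ e k ^ τ := Real.rpow_nonneg hek.le τ
    nlinarith [hAτ, mul_nonneg h8 hτ0]
  -- the three regrouped families
  refine ineq5714_knit P hcard he hq0 hq1 hek' hek1 hr hc hκ hτ (by norm_num : (0:ℝ) ≤ 2) (by norm_num : (0:ℝ) ≤ 2)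
    (by norm_num : (0:ℝ) ≤ 4)
    (fun j X => W₁ j X + if j = k then W₂ j X else 0) (fun j X => W₂ j X + W₆ j X)
    (fun j X => W₃ j X + W₄ j X + W₅ j X + if j = k then W₆ j X else 0) lfVol W
    (fun X => by rw [hW X]; exact regroup_six P W₁ W₂ W₃ W₄ W₅ W₆ k X) ?_ ?_ ?_ hg' hκR ?_ hBτ
  · -- (S1): W′_j (+ W″_k at j = k)
    intro j hj X
    have hA1 := h1 j hj X
    have hE : 0 ≤ e j ^ κ * Real.exp (-(c * rLen r (e k)) * P.cardMinus X) :=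
      mul_nonneg (Real.rpow_nonneg (eK_pos hL0 hε he₀ j).le κ) (Real.exp_pos _).le
    by_cases hjk : j = k
    · subst hjk
      rw [if_pos rfl]
      calc |W₁ j X + W₂ j X| ≤ |W₁ j X| + |W₂ j X| := abs_add_le _ _
        _ ≤ _ := by have := h2k X; show _ ≤ 2 * e j ^ κ * _; linarith
    · rw [if_neg hjk, add_zero]
      show _ ≤ 2 * e j ^ κ * _
      linarith
  · -- (S2): W″_j + W⁽ᵛⁱ⁾_j, j < k
    intro j hj X
    have hE : 0 ≤ e j ^ (1 - α) * Real.exp (-(c * rLen r (e k)) * P.card X) :=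
      mul_nonneg (Real.rpow_nonneg (eK_pos hL0 hε he₀ j).le _) (Real.exp_pos _).le
    have hv2 : (vol₂ j X : ℝ) ≤ lfVol j X := by exact_mod_cast hvol₂ j X
    have hv6 : (vol₆ j X : ℝ) ≤ lfVol j X := by exact_mod_cast hvol₆ j X
    have hA2 := (h2 j hj X).trans (mul_le_mul_of_nonneg_left hv2 hE)
    have hA6 := (h6 j hj X).trans (mul_le_mul_of_nonneg_left hv6 hE)
    calc |W₂ j X + W₆ j X| ≤ |W₂ j X| + |W₆ j X| := abs_add_le _ _
      _ ≤ _ := by show _ ≤ 2 * e j ^ (1 - α) * _ * _; linarith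
  · -- (S3): W‴_j + W⁽ⁱᵛ⁾_j + W⁽ᵛ⁾_j (+ W⁽ᵛⁱ⁾_k at j = k)
    intro j hj X
    have hA3 := h3 j hj X
    have hA4 := h4 j hj X
    have hA5 := h5 j hj X
    have hE : 0 ≤ Real.exp (-(c * rLen r (e j)) * P.card X) := (Real.exp_pos _).le
    by_cases hjk : j = k
    · subst hjk
      rw [if_pos rfl]
      have hA6 := h6k X
      calc |W₃ j X + W₄ j X + W₅ j X + W₆ j X| ≤ |W₃ j X| + |W₄ j X| + |W₅ j X| + |W₆ j X| := by
            exact (abs_add_le _ _).trans (add_le_add (abs_add_three _ _ _) le_rfl)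
        _ ≤ _ := by show _ ≤ 4 * _; linarith
    · rw [if_neg hjk, add_zero]
      calc |W₃ j X + W₄ j X + W₅ j X| ≤ |W₃ j X| + |W₄ j X| + |W₅ j X| := abs_add_three _ _ _
        _ ≤ _ := by show _ ≤ 4 * _; linarith
  · -- smallness: n_A/(1−q^κ) + 2 n_D with n_A = 2, n_D = 4
    have : (2 / (1 - (L ^ (-((4 - (d : ℝ)) / 2))) ^ κ) + 2 * 4) = (2 / (1 - (L ^ (-((4 - (d : ℝ)) / 2))) ^ κ) + 8) := by
      norm_num
    rw [this]
    exact hAτ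

end Pieces

end Literature.MathematicalPhysics.QuantumFieldTheory.BalabanImbrieJaffe1984to88.BIJ88Ineq5714Proof
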